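import Summits.KontsevichZagierPeriods.KontsevichZagierPeriods.Theses.K2SymbolChains
import Summits.KontsevichZagierPeriods.KontsevichZagierPeriods.Theorems.K2SymbolChainsJensenIsScissorsToolkit
import Literature.NumberTheory.Transcendental.KZSemialgebraicComplex

/-!
# `JensenMoveGlue` (stmt-KontsevichZagierPeriods-17791, route K2SymbolChains) — proof

`JensenMoveGlue : JensenMoveDisc → JensenMoveOutside → GenericDifferentiability → JensenMove`:
the glued split (D-0019) of the crux `JensenMove` ("the fibrewise torus average of the unfolded
`log |e^{iφ} − α(x)|` may be replaced by `2π log⁺|α(x)|` inside `KZ.relations`") into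

* `JensenMoveDisc` — the same move over bases on which the centre `α = α₁ + iα₂` is differentiable
  and `0 < |α| ≤ 1` (there `log⁺|α| = 0`: the torus representation itself is a relation);
* `JensenMoveOutside` — the same move over bases on which `α` is differentiable and `|α| > 1`;
* `GenericDifferentiability` — a `ℚ`-semialgebraic function on a `ℚ`-semialgebraic `τ ⊆ ℝⁿ` is
  differentiable at every point of a `ℚ`-semialgebraic `B ⊆ τ` with `τ ∖ B` Lebesgue-null.

This is the planner's published sorry-free split-glue proof
(`Cruxes/JensenMove/Lines/split_disc_outside_generic.lean`, theorem `JensenMove_of_subs` of the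
crux-strategist of stmt-KontsevichZagierPeriods-5199) re-homed under `Theorems/` by lead c10 of
crux stmt-KontsevichZagierPeriods-9129 (banking): its helper lemmas verbatim, its body as the
body of `jensenMoveGlue_proof` after introducing the three route constants. The glue is the
base bookkeeping of the paper chain [Jensen1899; KontsevichZagier2001, §1.2, rules 1)–2)]:
intersect the smooth loci of `α₁`, `α₂` (piece 3 twice), discard the null remainder of the base
(cylinders over null sets are null, rule 1a), discard the locus `α = 0` (there `|e(s) − α|² = 1`
identically, so the fibre of the torus representation is empty), cut the rest of the base into
the regimes `0 < |α| ≤ 1` and `|α| > 1` (semialgebraic sublevel sets, rule 1a), feed the two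
regimes to pieces 1 and 2, and observe that the `log⁺` representation `r′` lives over the
exterior regime up to a null set. Sources: J. L. W. V. Jensen, *Sur un nouvel et important
théorème de la théorie des fonctions*, Acta Math. 22 (1899); M. Kontsevich, D. Zagier,
*Periods* (2001), §1.2. [folklore]
-/

noncomputable section

open MeasureTheory Set
open Literature.NumberTheory.Transcendental Literature.ModelTheory.ExponentialFields

namespace Summit.KontsevichZagierPeriods.K2SymbolChains

namespace JensenMoveSplitGlue

open Literature.NumberTheory.Transcendental.KZ
open Summit.KontsevichZagierPeriods.K2SymbolChains.JensenIsScissorsProof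

variable {n : ℕ}

/-- The three scissors move sets lie in `KZ.relations`. [Kontsevich–Zagier 2001, §1.2] [folklore] -/
theorem scissors_subset_relations :
    domainAddRel ∪ integrandAddRel ∪ changeOfVariablesRel ⊆ (relations : AddSubgroup FormalRep) := by
  rintro c ((hc | hc) | hc)
  · exact domainAddRel_subset_relations hc
  · exact integrandAddRel_subset_relations hc
  · exact changeOfVariablesRel_subset_relations hc

/-- Cylinders `{(x, s, u) | x ∈ P}` over `ℚ`-semialgebraic subsets `P` of the base `ℝⁿ` are
`ℚ`-semialgebraic (an iterated `init`-cylinder). [folklore] -/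
theorem isSemialgebraic_cyl2 {P : Set (Fin n → ℝ)} (hP : IsSemialgebraic ℚ P) :
    IsSemialgebraic ℚ {w : Fin (n + 2) → ℝ | (fun i : Fin n => w (Fin.castAdd 2 i)) ∈ P} := by
  have h := isSemialgebraic_cyl (isSemialgebraic_cyl hP)
  exact h

/-- Cylinders over null subsets of the base are null. [folklore] -/
theorem volume_cyl2_eq_zero {P : Set (Fin n → ℝ)} (hP : volume P = 0) :
    volume {w : Fin (n + 2) → ℝ | (fun i : Fin n => w (Fin.castAdd 2 i)) ∈ P} = 0 := by
  have h := volume_setOf_init_mem_eq_zero (volume_setOf_init_mem_eq_zero hP)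
  exact h

/-- `|e(s) − 0|² = 1` for the rational point `e(s) = ((1 − s²) + 2is)/(1 + s²)` of the circle.
[folklore] -/
theorem ratCircle_normSq (s : ℝ) :
    ((1 - s ^ 2) / (1 + s ^ 2) - 0) ^ 2 + (2 * s / (1 + s ^ 2) - 0) ^ 2 = 1 := by
  have hs : (1 + s ^ 2) ≠ 0 := by positivity
  field_simp
  ring

end JensenMoveSplitGlue

open Literature.NumberTheory.Transcendental.KZ in
open Summit.KontsevichZagierPeriods.K2SymbolChains.JensenIsScissorsProof JensenMoveSplitGlue in
/-- **`JensenMoveGlue`** (route K2SymbolChains, stmt-KontsevichZagierPeriods-17791):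
`JensenMoveDisc → JensenMoveOutside → GenericDifferentiability → JensenMove` — Jensen on the
punctured closed disc with smooth centre, Jensen outside the closed disc with smooth centre, and
generic differentiability of `ℚ`-semialgebraic functions together give the fibrewise Jensen move
`of r − of r′ ∈ KZ.relations`. Proof: cut the base by rule 1a into the smooth regimes
`0 < |α| ≤ 1` (piece 1), `|α| > 1` (piece 2, with the matching piece of `r′`) and a remainder that
is null (off the common smooth locus of `α₁`, `α₂`, piece 3 twice) or has empty fibre (`α = 0`).
[Jensen 1899; Kontsevich–Zagier 2001, §1.2, rules 1)–2)] [folklore] -/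
theorem jensenMoveGlue_proof :
    Summit.KontsevichZagierPeriods.KontsevichZagierPeriods.Theses.K2SymbolChains.JensenMoveGlue := by
  intro hDisc hOut hGen n τ h α₁ α₂ r r' hτ hh hα₁ hα₂ hint hrd hri hr'd hr'i
  have hS := scissors_subset_relations
  -- Step 1: the common smooth locus `B` of `α₁`, `α₂`, of full measure in `τ`.
  obtain ⟨B₁, hB₁τ, hB₁, hB₁0, hd₁⟩ := hGen n τ α₁ hτ hα₁
  obtain ⟨B₂, hB₂τ, hB₂, hB₂0, hd₂⟩ := hGen n τ α₂ hτ hα₂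
  set B : Set (Fin n → ℝ) := B₁ ∩ B₂ with hB_def
  have hB : IsSemialgebraic ℚ B := hB₁.inter hB₂
  have hBτ : B ⊆ τ := fun x hx => hB₁τ hx.1
  have hτB0 : volume (τ \ B) = 0 := by
    refine measure_mono_null (fun x hx => ?_) (measure_union_null hB₁0 hB₂0)
    rcases hx with ⟨hxτ, hxB⟩
    by_cases h1 : x ∈ B₁
    · exact Or.inr ⟨hxτ, fun h2 => hxB ⟨h1, h2⟩⟩
    · exact Or.inl ⟨hxτ, h1⟩
  -- Step 2: the regimes `|α| > 1` (`Bo`) and `0 < |α| ≤ 1` (`Bd`) inside `B`.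
  set ρ2 : (Fin n → ℝ) → ℝ := fun x => α₁ x ^ 2 + α₂ x ^ 2 with hρ2_def
  have hρ2 : IsSemialgebraicFunOn ℚ B ρ2 :=
    (IsSemialgebraicFunOn.add_holds
      (IsSemialgebraicFunOn.mul_holds (hα₁.mono hBτ hB) (hα₁.mono hBτ hB))
      (IsSemialgebraicFunOn.mul_holds (hα₂.mono hBτ hB) (hα₂.mono hBτ hB))).congr fun x _ => by
      simp only [hρ2_def, Pi.add_apply, Pi.mul_apply]; ring
  set g : (Fin n → ℝ) → ℝ := fun x => 1 - ρ2 x with hg_def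
  have hg : IsSemialgebraicFunOn ℚ B g :=
    (IsSemialgebraicFunOn.sub_holds (isSemialgebraicFunOn_ratCast hB 1) hρ2).congr fun x _ => by
      simp [hg_def]
  set Bo : Set (Fin n → ℝ) := {x | x ∈ B ∧ g x < 0} with hBo_def
  have hBo : IsSemialgebraic ℚ Bo := hg.isSemialgebraic_sep_neg
  set Bc : Set (Fin n → ℝ) := {x | x ∈ B ∧ 0 ≤ g x} with hBc_def
  have hBc : IsSemialgebraic ℚ Bc := hg.isSemialgebraic_sep_nonneg
  have hBcB : Bc ⊆ B := fun x hx => hx.1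
  set Bd : Set (Fin n → ℝ) := {x | x ∈ Bc ∧ ρ2 x ≠ 0} with hBd_def
  have hBd : IsSemialgebraic ℚ Bd := (hρ2.mono hBcB hBc).isSemialgebraic_sep_ne_zero
  have hBoB : Bo ⊆ B := fun x hx => hx.1
  have hBdB : Bd ⊆ B := fun x hx => hx.1.1
  have hBoτ : Bo ⊆ τ := hBoB.trans hBτ
  have hBdτ : Bd ⊆ τ := hBdB.trans hBτ
  have hρ2_nonneg : ∀ x, 0 ≤ ρ2 x := fun x => by simp only [hρ2_def]; positivity
  have hBo_regime : ∀ x ∈ Bo, 1 < α₁ x ^ 2 + α₂ x ^ 2 := fun x hx => by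
    have := hx.2; simp only [hg_def, hρ2_def] at this; linarith
  have hBd_regime : ∀ x ∈ Bd, 0 < α₁ x ^ 2 + α₂ x ^ 2 ∧ α₁ x ^ 2 + α₂ x ^ 2 ≤ 1 := fun x hx => by
    have h1 := hx.1.2; have h2 := hx.2
    simp only [hg_def, hρ2_def] at h1 h2
    exact ⟨(hρ2_nonneg x).lt_of_ne (Ne.symm h2), by linarith⟩
  have hdiffB : ∀ x ∈ B, DifferentiableAt ℝ α₁ x ∧ DifferentiableAt ℝ α₂ x :=
    fun x hx => ⟨hd₁ x hx.1, hd₂ x hx.2⟩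
  -- the trichotomy on the base: outside `Bd ∪ Bo`, a point of `τ` is off `B` or has `α = 0`
  have htrich : ∀ x ∈ τ, x ∉ Bd → x ∉ Bo → x ∉ B ∨ (α₁ x = 0 ∧ α₂ x = 0) := by
    intro x _ hxd hxo
    by_cases hxB : x ∈ B
    · right
      have hg0 : 0 ≤ g x := not_lt.1 fun hlt => hxo ⟨hxB, hlt⟩
      have hρ0 : ρ2 x = 0 := by
        by_contra hne
        exact hxd ⟨⟨hxB, hg0⟩, hne⟩
      simp only [hρ2_def] at hρ0
      have h1 : α₁ x ^ 2 = 0 := by nlinarith [sq_nonneg (α₁ x), sq_nonneg (α₂ x)]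
      have h2 : α₂ x ^ 2 = 0 := by nlinarith [sq_nonneg (α₁ x), sq_nonneg (α₂ x)]
      exact ⟨pow_eq_zero_iff (n := 2) (by norm_num) |>.1 h1,
        pow_eq_zero_iff (n := 2) (by norm_num) |>.1 h2⟩
    · exact Or.inl hxB
  -- Step 3: cut `r` along the cylinders over `Bd` and `Bo`.
  set Cd : Set (Fin (n + 2) → ℝ) := {w | (fun i : Fin n => w (Fin.castAdd 2 i)) ∈ Bd} with hCd_def
  set Co : Set (Fin (n + 2) → ℝ) := {w | (fun i : Fin n => w (Fin.castAdd 2 i)) ∈ Bo} with hCo_def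
  have hCd : IsSemialgebraic ℚ Cd := isSemialgebraic_cyl2 hBd
  have hCo : IsSemialgebraic ℚ Co := isSemialgebraic_cyl2 hBo
  set rd := r.restrict (r.domain ∩ Cd) (r.isSemialgebraic_domain.inter hCd) inter_subset_left
    with hrd_def
  set r₁ := r.restrict (r.domain \ Cd) (r.isSemialgebraic_domain.diff hCd) sdiff_subset
    with hr₁_def
  have e1 : of r - of rd - of r₁ ∈ relations :=
    of_sub_restrict_inter_sub_restrict_diff_mem hS r hCd
  set ro := r₁.restrict (r₁.domain ∩ Co) (r₁.isSemialgebraic_domain.inter hCo) inter_subset_left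
    with hro_def
  set r₂ := r₁.restrict (r₁.domain \ Co) (r₁.isSemialgebraic_domain.diff hCo) sdiff_subset
    with hr₂_def
  have e2 : of r₁ - of ro - of r₂ ∈ relations :=
    of_sub_restrict_inter_sub_restrict_diff_mem hS r₁ hCo
  -- Step 4: the remainder `r₂` lives over `(τ ∖ B) ∪ {α = 0}`; over `{α = 0}` its fibre is empty.
  have e3 : of r₂ ∈ relations := by
    refine of_mem_of_volume_eq_zero hS r₂
      (measure_mono_null (fun w hw => ?_) (volume_cyl2_eq_zero hτB0))
    have hw : w ∈ (r.domain \ Cd) \ Co := hw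
    rcases hw with ⟨⟨hwr, hwd⟩, hwo⟩
    rw [hrd] at hwr
    rcases hwr with ⟨hxτ, hfib⟩
    rcases htrich _ hxτ hwd hwo with hxB | ⟨h10, h20⟩
    · exact ⟨hxτ, hxB⟩
    · exfalso
      rw [h10, h20, ratCircle_normSq] at hfib
      rcases hfib with ⟨h1, h2⟩ | ⟨h1, h2⟩ <;> linarith
  -- Step 5: piece 1 on the punctured-disc regime.
  have e4 : of rd ∈ relations := by
    refine hDisc n Bd h α₁ α₂ rd hBd (hh.mono hBdτ hBd) (hα₁.mono hBdτ hBd) (hα₂.mono hBdτ hBd)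
      (fun x hx => hdiffB x (hBdB hx)) hBd_regime (hint.mono_set hBdτ) ?_ ?_
    · show r.domain ∩ Cd = _
      ext w
      rw [hrd]
      simp only [mem_inter_iff, mem_setOf_eq, hCd_def]
      constructor
      · rintro ⟨⟨-, hf⟩, hx⟩; exact ⟨hx, hf⟩
      · rintro ⟨hx, hf⟩; exact ⟨⟨hBdτ hx, hf⟩, hx⟩
    · intro w hw
      exact hri w hw.1
  -- Step 6: piece 2 on the exterior regime, with the matching piece of `r′`.
  set r'o := r'.restrict (r'.domain ∩ Co) (r'.isSemialgebraic_domain.inter hCo) inter_subset_left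
    with hr'o_def
  have e5 : of ro - of r'o ∈ relations := by
    refine hOut n Bo h α₁ α₂ ro r'o hBo (hh.mono hBoτ hBo) (hα₁.mono hBoτ hBo) (hα₂.mono hBoτ hBo)
      (fun x hx => hdiffB x (hBoB hx)) hBo_regime (hint.mono_set hBoτ) ?_ ?_ ?_ ?_
    · show (r.domain \ Cd) ∩ Co = _
      ext w
      rw [hrd]
      simp only [mem_inter_iff, mem_sdiff, mem_setOf_eq, hCd_def, hCo_def]
      constructor
      · rintro ⟨⟨⟨-, hf⟩, -⟩, hx⟩; exact ⟨hx, hf⟩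
      · rintro ⟨hx, hf⟩
        refine ⟨⟨⟨hBoτ hx, hf⟩, fun hxd => ?_⟩, hx⟩
        have h1 := hxd.1.2; have h2 := hx.2
        exact absurd h2 (not_lt.2 h1)
    · intro w hw
      exact hri w hw.1.1
    · show r'.domain ∩ Co = _
      ext w
      rw [hr'd]
      simp only [mem_inter_iff, mem_setOf_eq, hCo_def]
      constructor
      · rintro ⟨⟨-, hf⟩, hx⟩; exact ⟨hx, hf⟩
      · rintro ⟨hx, hf⟩; exact ⟨⟨hBoτ hx, hf⟩, hx⟩
    · intro w hw
      exact hr'i w hw.1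
  -- Step 7: `r′` minus its exterior piece lives over `τ ∖ B` (its fibres over `|α| ≤ 1` are empty).
  have e6 : of r' - of r'o ∈ relations := by
    refine of_sub_of_mem_of_subset hS inter_subset_left
      (measure_mono_null (fun w hw => ?_) (volume_cyl2_eq_zero hτB0)) (fun _ _ => rfl)
    have hw : w ∈ r'.domain \ (r'.domain ∩ Co) := hw
    rcases hw with ⟨hwr, hwo⟩
    have hwo' : w ∉ Co := fun h' => hwo ⟨hwr, h'⟩
    rw [hr'd] at hwr
    rcases hwr with ⟨hxτ, h1, h2⟩
    refine ⟨hxτ, fun hxB => hwo' ⟨hxB, ?_⟩⟩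
    show g _ < 0
    simp only [hg_def, hρ2_def]
    linarith
  -- Step 8: sum up.
  have : of r - of r' = (of r - of rd - of r₁) + (of r₁ - of ro - of r₂) + of r₂ + of rd +
      (of ro - of r'o) - (of r' - of r'o) := by abel
  rw [this]
  exact relations.sub_mem (relations.add_mem (relations.add_mem (relations.add_mem
    (relations.add_mem e1 e2) e3) e4) e5) e6

end Summit.KontsevichZagierPeriods.K2SymbolChains
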